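import Summits.ResolutionOfSingularities.ResolutionOfSingularities.Theorems.FrobeniusLadderFRationalResolutionBlowupSmoothAscent
import Summits.ResolutionOfSingularities.ResolutionOfSingularities.Theorems.FrobeniusLadderFRationalResolutionBlowupOrbitCentre
import Mathlib.RingTheory.RingHom.Smooth
import HarnessLib

/-!
# Crux `FrobeniusLadder.FRationalResolution` (stmt-ResolutionOfSingularities-15317), line `redirect`,
# stub `stub_diagonalizableQuotientResolution` — regularity of `Bl_J(Spec C)` survives the base change of the chart `C` along a SMOOTH
# `B → B''` (Galois route: `B'' = (B ⊗_K K')_h`, chart `B'' ⊗_B C`)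

* **`isRegular_affineBlowup_includeRight_of_smooth`** — `Spec B'' → Spec B` smooth, `Bl_J(Spec C)` regular ⇒
  `Bl_{J (B'' ⊗_B C)}(Spec (B'' ⊗_B C))` regular (ring-hom smoothness is stable under base change, Mathlib
  `RingHom.Smooth.isStableUnderBaseChange`; `…BlowupSmoothAscent.isRegular_affineBlowup_map_of_smooth`; transport along
  `C ⊗_B B'' ≅ B'' ⊗_B C`).

Honest label: generic plumbing (no stub closed by name). No definitions, no named facts, no sorry.
[cite: GortzWedhorn2020, Prop. 13.91 (2)] [cite: Grothendieck1967, Prop. 17.5.8 (iii)]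
-/

noncomputable section

-- single-problem summit: the doubled namespace component is forced
set_option linter.dupNamespace false

open CategoryTheory AlgebraicGeometry TopologicalSpace TensorProduct
open Literature.AlgebraicGeometry.Resolution
open Summit.ResolutionOfSingularities.ResolutionOfSingularities.Theorems.FRationalResolution

namespace Summit.ResolutionOfSingularities.ResolutionOfSingularities.Theorems.FRationalResolution.BlowupTensorAscent

/-- **Regularity of `Bl_J(Spec C)` survives a smooth base change of the chart.** Let `B → B''` be such that `Spec B'' → Spec B`
is smooth, `C` a Noetherian `B`-algebra and `J ⊆ C` with `Bl_J(Spec C)` regular. Then the blow-up of `Spec(B'' ⊗_B C)` along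
`J (B'' ⊗_B C)` is regular. [cite: GortzWedhorn2020, Prop. 13.91 (2)] [cite: Grothendieck1967, Prop. 17.5.8 (iii)] -/
theorem isRegular_affineBlowup_includeRight_of_smooth {B B'' C : Type} [CommRing B] [CommRing B''] [CommRing C]
    [Algebra B B''] [Algebra B C] [IsNoetherianRing C] [Smooth (Spec.map (CommRingCat.ofHom (algebraMap B B'')))]
    (J : Ideal C) (hreg : Scheme.IsRegular (affineBlowup J)) :
    Scheme.IsRegular (affineBlowup
      (J.map ((Algebra.TensorProduct.includeRight : C →ₐ[B] B'' ⊗[B] C) : C →+* B'' ⊗[B] C))) := by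
  -- ring-hom smoothness of `B → B''`, base-changed to `C → C ⊗_B B''`
  have hsm : (algebraMap B B'').Smooth := by
    have h := (HasRingHomProperty.Spec_iff (P := @Smooth) (φ := CommRingCat.ofHom (algebraMap B B''))).mp inferInstance
    rwa [CommRingCat.hom_ofHom] at h
  have hsm' : (algebraMap C (C ⊗[B] B'')).Smooth := RingHom.Smooth.isStableUnderBaseChange.tensorProduct C hsm
  haveI : Smooth (Spec.map (CommRingCat.ofHom (algebraMap C (C ⊗[B] B'')))) := by
    rw [HasRingHomProperty.Spec_iff (P := @Smooth), CommRingCat.hom_ofHom]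
    exact hsm'
  have h1 : Scheme.IsRegular (affineBlowup (J.map (algebraMap C (C ⊗[B] B'')))) :=
    BlowupSmoothAscent.isRegular_affineBlowup_map_of_smooth (algebraMap C (C ⊗[B] B'')) J hreg
  -- transport along `C ⊗_B B'' ≅ B'' ⊗_B C`
  let e : C ⊗[B] B'' ≃+* B'' ⊗[B] C := (Algebra.TensorProduct.comm B C B'').toRingEquiv
  have hcomp : (e : C ⊗[B] B'' →+* B'' ⊗[B] C).comp (algebraMap C (C ⊗[B] B'')) =
      ((Algebra.TensorProduct.includeRight : C →ₐ[B] B'' ⊗[B] C) : C →+* B'' ⊗[B] C) := by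
    ext c
    simp only [RingHom.coe_comp, Function.comp_apply, Algebra.TensorProduct.algebraMap_apply, Algebra.algebraMap_self,
      RingHom.id_apply]
    show (Algebra.TensorProduct.comm B C B'') (c ⊗ₜ[B] (1 : B'')) = (1 : B'') ⊗ₜ[B] c
    exact Algebra.TensorProduct.comm_tmul B c (1 : B'')
  have h2 := BlowupOrbitCentre.isRegular_affineBlowup_map_of_ringEquiv e _ h1
  rw [Ideal.map_map, hcomp] at h2
  exact h2

end Summit.ResolutionOfSingularities.ResolutionOfSingularities.Theorems.FRationalResolution.BlowupTensorAscent

end
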